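import Summits.KontsevichZagierPeriods.KontsevichZagierPeriods.Theses.ScissorsTransport
import Summits.KontsevichZagierPeriods.KontsevichZagierPeriods.Theorems.ScissorsTransportCylinderReduction
import Summits.KontsevichZagierPeriods.KontsevichZagierPeriods.Theorems.SymplecticScissorsAssembly

/-!
# Route ScissorsTransport — assembly `Assembly` (stmt-KontsevichZagierPeriods-2673)

`StableSetTransport → KontsevichZagierPeriods`: the Monge/transport form of Conjecture 1 (thesis X
of the route) implies the summit. The proof FACTORS through the volume form, exactly as the route
text foresees, and every factor but the first arrow is already in the tree:

* **Cylinder reduction** (support item `CylinderReduction`, landed as `CylinderReduction_proof`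
  in `Theorems/ScissorsTransportCylinderReduction.lean`): an integrand-`1` representation `r` of
  dimension `N` is KZ-equivalent to every integrand-`1` representation `s` of dimension `N + M`
  whose domain is a full-measure subset of the cylinder
  `{z | (i ↦ z (castAdd M i)) ∈ r.domain ∧ ∀ j, z (natAdd N j) ∈ [0, 1]}` (`M` slab moves and one
  null removal).
* **X → VolumeForm** (`volumeForm_of_stableSetTransport`, proved here): for integrand-`1`
  representations `r, r'` of one dimension with equal value, X supplies `s ⊆ cyl r`,
  `s' ⊆ cyl r'` of full measure with `[s] − [s'] ∈ changeOfVariablesRel ⊆ relations`; compose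
  with two cylinder reductions.
* **VolumeForm → KontsevichZagierPeriods** (the route decl `Assembly2`, shared item
  stmt-KontsevichZagierPeriods-3822, landed as
  `Summit.KontsevichZagierPeriods.VolumeFormAssembly.scissorsTransport_assembly2_proof` in
  `Theorems/SymplecticScissorsAssembly.lean`): `VolumeForm` specialises to the printed volume
  conjecture `KZ.volumeConjectureCompact`, equivalent to the two-representation form of
  Conjecture 1 by `KZ.kzPeriodConjecture'_iff_volumeConjectureCompact_holds` [Cresson–Viu-Sos 2022,
  §1 p. 326, over Viu-Sos 2021 Thm. 1.1 discharged in tree], which restricts to the summit.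

Sources: M. Kontsevich, D. Zagier, *Periods* (2001), §1.2 (rules (1)–(3), Conjecture 1);
J. Viu-Sos, IJNT 17 (2021), Thm. 1.1; J. Cresson, J. Viu-Sos, JTNB 34 (2022), §1 p. 326 and
§2.1–2.2 (Problem 2.1).
Deliberately NOT here: any claim about `StableSetTransport` itself (crux, open, summit-strength).
-/

namespace Summit.KontsevichZagierPeriods.ScissorsTransport

open Literature.NumberTheory.Transcendental Literature.NumberTheory.Transcendental.KZ

/-- **X → VolumeForm.** The Monge/transport form `StableSetTransport` of Conjecture 1 implies its
volume form `VolumeForm` (two integrand-`1` representations of one dimension with equal value are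
KZ-equivalent): X supplies full-measure restrictions `s ⊆ cyl r`, `s' ⊆ cyl r'` of the two
cylinders related by ONE change-of-variables move, `changeOfVariablesRel ⊆ relations`
(`KZ.changeOfVariablesRel_subset_relations`), and both ends are reached by cylinder reduction
(`CylinderReduction_proof`): `[r] ≡ [s] ≡ [s'] ≡ [r']`.
[Cresson–Viu-Sos 2022, §2.1 (Problem 2.1); Kontsevich–Zagier 2001, §1.2] -/
theorem volumeForm_of_stableSetTransport :
    Summit.KontsevichZagierPeriods.KontsevichZagierPeriods.Theses.ScissorsTransport.StableSetTransport →
    Summit.KontsevichZagierPeriods.KontsevichZagierPeriods.Theses.ScissorsTransport.VolumeForm := by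
  unfold Summit.KontsevichZagierPeriods.KontsevichZagierPeriods.Theses.ScissorsTransport.VolumeForm
  unfold Summit.KontsevichZagierPeriods.KontsevichZagierPeriods.Theses.ScissorsTransport.StableSetTransport
  intro hX N r r' h1 h1' hv
  obtain ⟨M, s, s', hs, hsn, hs', hs'n, hs1, hs'1, hcov⟩ := hX r r' h1 h1' hv
  have e₁ : Equivalent r s := CylinderReduction_proof r s h1 hs hsn hs1
  have e₂ : Equivalent r' s' := CylinderReduction_proof r' s' h1' hs' hs'n hs'1
  have e₃ : Equivalent s s' := changeOfVariablesRel_subset_relations hcov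
  exact (e₁.trans e₃).trans e₂.symm

/-- **Route ScissorsTransport, assembly `Assembly` (stmt-KontsevichZagierPeriods-2673):**
`StableSetTransport → KontsevichZagierPeriods`. The hypothesis is literally the text of the crux
`StableSetTransport`; compose X → VolumeForm (`volumeForm_of_stableSetTransport`: cylinder
reduction + one change-of-variables move) with the landed second assembly VolumeForm → summit
(`Summit.KontsevichZagierPeriods.VolumeFormAssembly.scissorsTransport_assembly2_proof`, the route
decl `Assembly2`). [Kontsevich–Zagier 2001, §1.2, Conjecture 1; Cresson–Viu-Sos 2022, §1, §2.1] -/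
theorem Assembly_proof :
    Summit.KontsevichZagierPeriods.KontsevichZagierPeriods.Theses.ScissorsTransport.Assembly := by
  unfold Summit.KontsevichZagierPeriods.KontsevichZagierPeriods.Theses.ScissorsTransport.Assembly
  intro hX
  have h₂ := Summit.KontsevichZagierPeriods.VolumeFormAssembly.scissorsTransport_assembly2_proof
  unfold Summit.KontsevichZagierPeriods.KontsevichZagierPeriods.Theses.ScissorsTransport.Assembly2 at h₂
  exact h₂ (volumeForm_of_stableSetTransport hX)

end Summit.KontsevichZagierPeriods.ScissorsTransport
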